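import Summits.HubbardSuperconductivity.HubbardSuperconductivity.Theorems.AnisotropyChordTowerParticleHole

/-!
# Route `AnisotropyChord` / H0 rotor rung: THE EXTREME SECTORS `n ∈ {0, 1, |V|−1, |V|}` — there the Perron amplitude is flat and
# its spin deficit vanishes (work-order v13(e), case `|M'| ≥ S − 1`, of theory seat `hubbard-h0-rotor-theory-1`, memo §161 (e))

* `inner_fmOp_eq_zero_of_const` : an amplitude constant on its particle-number sector has `⟨a, A a⟩ = 0` for EVERY graph form
  (in particular the complete-graph / spin-deficit form);
* `insideOrd_eq_zero_of_one`, `isingW_of_zerosCard_one`, `isingW_of_zerosCard_pred` : on a graph with constant degree `d` the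
  Ising bond sum is the constant `D/8 − d/2` on the one-particle and one-hole sectors;
* **`perron_const_of_isingW_const`** : if `W` is constant on the sector, the Perron amplitude is constant there (Rayleigh–Ritz
  against the flat vector forces `⟨a, A a⟩ = 0`, then connectivity);
* `eq_of_zerosCard_zero`, `eq_of_zerosCard_card` : the empty and the full sector are singletons;
* **`perron_inner_top_eq_zero_of_edge`** : for a Perron amplitude of the torus whose sector has `n ≤ 1` or `n ≥ |V| − 1` up spins,
  `Σ a·(B a) = 0` (`B = fmOp ⊤`), i.e. `⟨S⃗²⟩ = S(S+1)` is maximal.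
-/

set_option linter.dupNamespace false
set_option autoImplicit false

noncomputable section

open Finset Matrix
open Summit.HubbardSuperconductivity.HubbardSuperconductivity.Theorems.AnisotropyChord.InsertionEntropy
open Literature.MathematicalPhysics.QuantumLattice Literature.Probability.LatticeModels

namespace Summit.HubbardSuperconductivity.HubbardSuperconductivity.Theorems.AnisotropyChord.Tower

variable {V : Type} [Fintype V] [DecidableEq V]

/-- Every element of `Fin 2` is `0` or `1`. [folklore] -/
private theorem fin2_cases₄ (i : Fin 2) : i = 0 ∨ i = 1 := by
  rcases i with ⟨_ | _ | k, hk⟩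
  · left; rfl
  · right; rfl
  · omega

section General

variable (G : SimpleGraph V) [DecidableRel G.Adj]

/-- **A sector-wise constant amplitude has vanishing graph form** (any graph). [folklore] -/
theorem inner_fmOp_eq_zero_of_const (a : (V → Fin 2) → ℝ) (n : ℝ) (hsupp : ∀ σ, a σ ≠ 0 → zerosCard σ = n)
    (hconst : ∀ σ σ', zerosCard σ = n → zerosCard σ' = n → a σ = a σ') :
    ∑ σ, a σ * fmOp G a σ = 0 := by
  by_cases hex : ∃ σ₀ : V → Fin 2, zerosCard σ₀ = n
  · obtain ⟨σ₀, hσ₀⟩ := hex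
    have ha : a = fun σ => (fun t : ℝ => if t = n then a σ₀ else 0) (zerosCard σ) := by
      funext σ
      by_cases hσ : zerosCard σ = n
      · simp only [hσ, if_true]; exact hconst σ σ₀ hσ hσ₀
      · simp only [hσ, if_false]; by_contra h; exact hσ (hsupp σ h)
    have h0 := fmOp_sectorFun G (fun t : ℝ => if t = n then a σ₀ else 0)
    rw [ha, h0]; simp
  · have ha : a = fun _ => 0 := by
      funext σ; by_contra h; exact hex ⟨σ, hsupp σ h⟩
    rw [ha]; simp

/-- On the one-particle sector no two zeros are adjacent: `insideOrd = 0`. [folklore] -/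
theorem insideOrd_eq_zero_of_one (σ : V → Fin 2) (h : zerosCard σ = 1) : insideOrd G σ = 0 := by
  have hcard : (zeroSet σ).card = 1 := by rw [zerosCard_eq_card] at h; exact_mod_cast h
  obtain ⟨x₀, hx₀⟩ := Finset.card_eq_one.1 hcard
  have hzero : ∀ x, σ x = 0 → x = x₀ := fun x hx => by
    have : x ∈ zeroSet σ := mem_zeroSet.2 hx
    rw [hx₀, Finset.mem_singleton] at this; exact this
  unfold insideOrd
  refine Finset.sum_eq_zero fun x _ => Finset.sum_eq_zero fun y _ => ?_
  rw [if_neg]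
  rintro ⟨hadj, hx, hy⟩
  rw [hzero x hx, hzero y hy] at hadj
  exact hadj.ne rfl

/-- **`W` is constant on the one-particle sector** of a graph with constant degree `d`: `isingW = D/8 − d/2`. [folklore] -/
theorem isingW_of_zerosCard_one (d : ℕ) (hreg : ∀ x : V, (∑ y, if G.Adj x y then (1:ℝ) else 0) = d)
    (σ : V → Fin 2) (h : zerosCard σ = 1) :
    isingW G σ = (1/8 : ℝ) * (∑ x, ∑ y, if G.Adj x y then (1:ℝ) else 0) - (d : ℝ) / 2 := by
  have h1 := isingW_eq G σ
  have h2 := degree_count G d hreg σ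
  rw [h, insideOrd_eq_zero_of_one G σ h] at h2
  rw [h1]; linarith

/-- **`W` is constant on the one-hole sector**: `isingW = D/8 − d/2` when `zerosCard = |V| − 1`. [folklore] -/
theorem isingW_of_zerosCard_pred (d : ℕ) (hreg : ∀ x : V, (∑ y, if G.Adj x y then (1:ℝ) else 0) = d)
    (σ : V → Fin 2) (h : zerosCard σ = (Fintype.card V : ℝ) - 1) :
    isingW G σ = (1/8 : ℝ) * (∑ x, ∑ y, if G.Adj x y then (1:ℝ) else 0) - (d : ℝ) / 2 := by
  rw [← isingW_flipAll G σ]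
  exact isingW_of_zerosCard_one G d hreg (flipAll σ) (by rw [zerosCard_flipAll, h]; ring)

omit [DecidableEq V] in
/-- The empty sector is a singleton: `zerosCard σ = 0 ⇒ σ = 1`. [folklore] -/
theorem eq_of_zerosCard_zero (σ : V → Fin 2) (h : zerosCard σ = 0) : σ = fun _ => 1 := by
  have hcard : (univ.filter fun x => σ x = 0).card = 0 := by unfold zerosCard at h; exact_mod_cast h
  rw [Finset.card_eq_zero] at hcard
  funext x
  rcases fin2_cases₄ (σ x) with hx | hx
  · have : x ∈ univ.filter fun x => σ x = 0 := by simp [hx]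
    rw [hcard] at this; exact absurd this (Finset.notMem_empty x)
  · exact hx

omit [DecidableEq V] in
/-- The full sector is a singleton: `zerosCard σ = |V| ⇒ σ = 0`. [folklore] -/
theorem eq_of_zerosCard_card (σ : V → Fin 2) (h : zerosCard σ = (Fintype.card V : ℝ)) : σ = fun _ => 0 := by
  have hcard : (univ.filter fun x => σ x = 0).card = (univ : Finset V).card := by
    unfold zerosCard at h; rw [Finset.card_univ]; exact_mod_cast h
  have heq := Finset.eq_of_subset_of_card_le (Finset.filter_subset _ _) hcard.ge
  funext x
  have : x ∈ univ.filter fun x => σ x = 0 := by rw [heq]; exact Finset.mem_univ x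
  simpa using this

end General

/-! ### On the torus -/

section Torus

variable {L : ℕ} [NeZero L]

/-- **If `W` is constant on the sector, the Perron amplitude is constant there** (so `⟨a, A a⟩ = 0` for every graph form).
[folklore] -/
theorem perron_const_of_isingW_const {Δ M : ℝ} {a : TensorIndex (TorusSite 2 L) 2 → ℝ}
    (ha : IsPerronSectorGroundAmplitude L Δ M a) (w : ℝ)
    (hW : ∀ σ, zerosCard σ = (Fintype.card (TorusSite 2 L) : ℝ) / 2 + M → isingW (torusGraph 2 L) σ = w) :
    ∀ σ σ', zerosCard σ = (Fintype.card (TorusSite 2 L) : ℝ) / 2 + M →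
      zerosCard σ' = (Fintype.card (TorusSite 2 L) : ℝ) / 2 + M → a σ = a σ' := by
  intro σ₁ σ₂ hσ₁ hσ₂
  obtain ⟨σ₀, hσ₀⟩ : ∃ σ₀, a σ₀ ≠ 0 := by
    by_contra h; push Not at h
    have : ∑ σ, a σ ^ 2 = 0 := Finset.sum_eq_zero fun σ _ => by rw [h σ]; ring
    rw [ha.unit] at this; exact one_ne_zero this
  have hn₀ := perron_support ha σ₀ hσ₀
  have key : ∑ σ, a σ * fmOp (torusGraph 2 L) a σ = 0 := by
    -- the flat competitor on the sector
    let b : TensorIndex (TorusSite 2 L) 2 → ℝ :=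
      fun σ => if zerosCard σ = (Fintype.card (TorusSite 2 L) : ℝ) / 2 + M then (1:ℝ) else 0
    have hb_apply : ∀ σ, b σ = if zerosCard σ = (Fintype.card (TorusSite 2 L) : ℝ) / 2 + M then (1:ℝ) else 0 :=
      fun σ => rfl
    have hbsupp : ∀ σ, b σ ≠ 0 → zerosCard σ = (Fintype.card (TorusSite 2 L) : ℝ) / 2 + M := by
      intro σ hσ; by_contra h; exact hσ (by rw [hb_apply, if_neg h])
    have hAb : fmOp (torusGraph 2 L) b = fun _ => 0 := by
      have h := fmOp_sectorFun (torusGraph 2 L)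
        (fun t : ℝ => if t = (Fintype.card (TorusSite 2 L) : ℝ) / 2 + M then (1:ℝ) else 0)
      beta_reduce at h
      exact h
    have hb0 : b σ₀ = 1 := by rw [hb_apply, if_pos hn₀]
    have hbpos : 0 < ∑ σ, b σ ^ 2 := by
      have hle := Finset.single_le_sum (f := fun σ => b σ ^ 2) (fun σ _ => sq_nonneg (b σ)) (Finset.mem_univ σ₀)
      rw [hb0, one_pow] at hle
      exact lt_of_lt_of_le one_pos hle
    have hR := rayleigh_real Δ M b hbsupp
    have hRHS : ∑ σ, b σ * (fmOp (torusGraph 2 L) b σ + (1 - Δ) * (isingW (torusGraph 2 L) σ * b σ))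
        = (1 - Δ) * w * ∑ σ, b σ ^ 2 := by
      rw [hAb, Finset.mul_sum]
      refine Finset.sum_congr rfl fun σ _ => ?_
      by_cases hσ : b σ = 0
      · rw [hσ]; ring
      · rw [hW σ (hbsupp σ hσ)]; ring
    rw [hRHS] at hR
    have hE : lowestEnergyInSector 1 (xxzHamiltonian 1 (torusGraph 2 L) (-1) Δ) M
        + (1/8 : ℝ) * (∑ x, ∑ y, if (torusGraph 2 L).Adj x y then (1:ℝ) else 0) ≤ (1 - Δ) * w := by
      by_contra hlt
      push Not at hlt
      have := mul_lt_mul_of_pos_right hlt hbpos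
      linarith
    -- the energy of `a`: `⟨a, A a⟩ + (1−Δ) w = E + D/8`
    have hEa := perron_energy_real ha
    have hsplit : ∑ σ, a σ * (fmOp (torusGraph 2 L) a σ + (1 - Δ) * (isingW (torusGraph 2 L) σ * a σ))
        = ∑ σ, a σ * fmOp (torusGraph 2 L) a σ + (1 - Δ) * w * ∑ σ, a σ ^ 2 := by
      rw [Finset.mul_sum, ← Finset.sum_add_distrib]
      refine Finset.sum_congr rfl fun σ _ => ?_
      by_cases hσ : a σ = 0
      · rw [hσ]; ring
      · rw [hW σ (perron_support ha σ hσ)]; ring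
    rw [hsplit, ha.unit, mul_one] at hEa
    exact le_antisymm (by linarith) (inner_fmOp_nonneg (torusGraph 2 L) a)
  have hconst := sectorFun_of_edgeSwapInvariant (torusGraph 2 L) (torusGraph_connected_of_proj 2 L) a
    (swapInvariant_of_inner_fmOp_eq_zero (torusGraph 2 L) a key)
  exact hconst σ₁ σ₂ (by rw [hσ₁, hσ₂])

/-- **THE EXTREME SECTORS HAVE MAXIMAL SPIN:** for a Perron amplitude of `H(Δ)` on the torus (constant degree `d`)
whose sector has `n ≤ 1` or `n ≥ |V| − 1` up spins, the complete-graph form vanishes: `Σ a·(B a) = 0`. [folklore] -/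
theorem perron_inner_top_eq_zero_of_edge {Δ M : ℝ} {a : TensorIndex (TorusSite 2 L) 2 → ℝ}
    (ha : IsPerronSectorGroundAmplitude L Δ M a) (d : ℕ)
    (hreg : ∀ x : TorusSite 2 L, (∑ y, if (torusGraph 2 L).Adj x y then (1:ℝ) else 0) = d)
    (hedge : (Fintype.card (TorusSite 2 L) : ℝ) / 2 + M = 0 ∨ (Fintype.card (TorusSite 2 L) : ℝ) / 2 + M = 1 ∨
      (Fintype.card (TorusSite 2 L) : ℝ) / 2 + M = (Fintype.card (TorusSite 2 L) : ℝ) - 1 ∨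
      (Fintype.card (TorusSite 2 L) : ℝ) / 2 + M = (Fintype.card (TorusSite 2 L) : ℝ)) :
    ∑ σ, a σ * fmOp (⊤ : SimpleGraph (TorusSite 2 L)) a σ = 0 := by
  refine inner_fmOp_eq_zero_of_const ⊤ a _ (perron_support ha) ?_
  rcases hedge with h | h | h | h
  · intro σ σ' hσ hσ'
    rw [eq_of_zerosCard_zero σ (by rw [hσ, h]), eq_of_zerosCard_zero σ' (by rw [hσ', h])]
  · exact perron_const_of_isingW_const ha _ fun σ hσ =>
      isingW_of_zerosCard_one (torusGraph 2 L) d hreg σ (by rw [hσ, h])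
  · exact perron_const_of_isingW_const ha _ fun σ hσ =>
      isingW_of_zerosCard_pred (torusGraph 2 L) d hreg σ (by rw [hσ, h])
  · intro σ σ' hσ hσ'
    rw [eq_of_zerosCard_card σ (by rw [hσ, h]), eq_of_zerosCard_card σ' (by rw [hσ', h])]

end Torus

end Summit.HubbardSuperconductivity.HubbardSuperconductivity.Theorems.AnisotropyChord.Tower
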